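import Literature.Dynamics.SymbolicDynamics.PeriodicPointFactsProofs
import HarnessLib

/-!
# Hochman 2025, Thm. 1.1: reduction to a combinatorial core on `ℤ × ℤ`

`PeriodicPointFactsProofs.lean` reduces the named fact `Hochman2025_existsSIAperiodic` (Hochman,
Discrete Analysis 2025:17, Thm. 1.1) to its instance `d = 2`
(`Hochman2025_existsSIAperiodic.of_two`).
This file reduces that instance further to the purely combinatorial statement that the printed
construction (§§5–6) actually delivers, removing all topology from what remains to be formalized:

* `Hochman2025_existsSIAperiodic.of_core`: the fact follows from the existence of a finite alphabet
  `Fin k` and a family `X₀ ⊆ (Fin k)^{ℤ × ℤ}` of configurations (NOT necessarily closed) which is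
  non-empty, shift-invariant, strongly irreducible with some gap `g` ALONG FINITE SETS
  (`IsFinitelyStronglyIrreducible`, Hochman's (B) of §6.1), and *uniformly locally aperiodic*
  (`IsUniformlyLocallyAperiodic`: for every `n ≥ 1` some `R` such that every `(2R+1)`-box of every
  `x ∈ X₀` contains two sites, congruent modulo `n` in both coordinates, carrying different
  symbols).

In the paper `X = {x | x admits a dense compatible certificate}` (§5.7); its closedness (Lemma 5.7)
rests on a compactness argument for the space of certificates that the paper only sketches
("This argument is flawed ... One can correct this flaw as follows", p. 25). The route formalized
here takes instead `X :=` the CLOSURE of the certified family `X₀` and never needs Lemma 5.7: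

1. the closure of a shift-invariant family is a subshift (`isSubshift_closure`);
2. finite-set strong irreducibility passes to the closure
   (`IsFinitelyStronglyIrreducible.closure`, in `StrongIrreducibility.lean`) and, for a closed
   family over a finite alphabet, is equivalent to strong irreducibility along all pairs of sets
   (`IsFinitelyStronglyIrreducible.isStronglyIrreducible`, ibid. — Hochman §6.1 "(A) follows from
   (B)");
3. uniform local aperiodicity of `X₀` forbids finite orbits in its closure
   (`IsUniformlyLocallyAperiodic.not_hasFiniteOrbit_of_mem_closure`): a configuration with finite
   `ℤ²`-orbit is `(mn)ℤ²`-periodic (`hasFiniteOrbit_iff_exists_shift_eq`), and its central box is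
   the central box of some member of `X₀`, which contains an `mn`-aperiodic pair. In the paper the
   corresponding statement is Lemma 5.5 (compatible ⟹ aperiodic), the uniformity coming from the
   density of frames;
4. the passage `ℤ × ℤ ↝ (Fin 2 → ℤ)` (`Hochman2025.ofFin`, an isometric additive identification)
   is bookkeeping.

## Main statements

* `IsShiftInvariant.closure`, `isSubshift_closure`.
* `IsUniformlyLocallyAperiodic` and `IsUniformlyLocallyAperiodic.not_hasFiniteOrbit_of_mem_closure`.
* `Hochman2025.exists_int2_of_core` — the five properties of Thm. 1.1 on `ℤ × ℤ` from a core family.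
* `Hochman2025_existsSIAperiodic.of_int2`, `Hochman2025_existsSIAperiodic.of_core`.

## References

* [Hochman2025] M. Hochman, *Irreducibility and periodicity in `ℤ²` symbolic systems*, Discrete
  Analysis 2025:17 — Thm. 1.1; §5.7 Lemmas 5.5–5.8, Cor. 5.9; §6.1 (A)–(B). Read via
  `lit read arxiv:2401.02273`.
-/

open Set
open _root_.SymbolicDynamics.FullShift

namespace Literature.Dynamics.SymbolicDynamics

variable {A : Type*}

/-! ### Closures of shift-invariant families -/

/-- The closure of a shift-invariant family is shift-invariant (shifts are continuous).
[folklore] -/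
theorem IsShiftInvariant.closure [TopologicalSpace A] {G : Type*} [AddMonoid G] {X : Set (G → A)}
    (h : IsShiftInvariant X) : IsShiftInvariant (closure X) :=
  fun v => (h v).closure (continuous_shift v)

/-- The closure of a shift-invariant family is a subshift. [folklore] -/
theorem isSubshift_closure [TopologicalSpace A] {G : Type*} [AddMonoid G] {X : Set (G → A)}
    (h : IsShiftInvariant X) : IsSubshift (closure X) :=
  ⟨isClosed_closure, h.closure⟩

/-! ### Uniform local aperiodicity -/

/-- `X ⊆ A^{ℤ × ℤ}` is *uniformly locally aperiodic*: for every `n ≥ 1` there is a radius `R` such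
that for every `x ∈ X` and every centre `c`, the box `c + [-R, R]²` contains two sites `u, v` with
`u ≡ v (mod n)` in both coordinates and `x u ≠ x v` (an *`n`-aperiodic pair*, Hochman §1.2, at
bounded distance from every site — the "syndeticity" of §1.2 made uniform over `X`).
[cite: Hochman2025, §1.2] -/
def IsUniformlyLocallyAperiodic (X : Set (ℤ × ℤ → A)) : Prop :=
  ∀ n : ℕ, 0 < n → ∃ R : ℕ, ∀ x ∈ X, ∀ c : ℤ × ℤ, ∃ u v : ℤ × ℤ,
    |u.1 - c.1| ≤ R ∧ |u.2 - c.2| ≤ R ∧ |v.1 - c.1| ≤ R ∧ |v.2 - c.2| ≤ R ∧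
      (n : ℤ) ∣ u.1 - v.1 ∧ (n : ℤ) ∣ u.2 - v.2 ∧ x u ≠ x v

/-- A horizontal period `(m, 0)` gives all the periods `(a m, 0)`. [folklore] -/
theorem apply_add_mul_fst_of_shift_eq {z : ℤ × ℤ → A} {m : ℤ} (h : shift (m, (0 : ℤ)) z = z)
    (a : ℤ) (p : ℤ × ℤ) : z (p + (a * m, 0)) = z p := by
  have step : ∀ q : ℤ × ℤ, z ((m, (0 : ℤ)) + q) = z q := fun q => by
    have := congrFun h q
    simpa using this
  induction a using Int.induction_on generalizing p with
  | zero =>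
    have e : p + ((0 : ℤ) * m, (0 : ℤ)) = p := by ext <;> simp
    rw [e]
  | succ a ih =>
    have e : p + ((a + 1) * m, (0 : ℤ)) = (m, 0) + (p + (a * m, 0)) := by
      ext
      · simp only [Prod.fst_add]; ring
      · simp
    rw [e, step, ih]
  | pred a ih =>
    have e : (m, (0 : ℤ)) + (p + ((-(a : ℤ) - 1) * m, 0)) = p + (-(a : ℤ) * m, 0) := by
      ext
      · simp only [Prod.fst_add]; ring
      · simp
    have := step (p + ((-(a : ℤ) - 1) * m, 0))
    rw [e, ih] at this
    exact this.symm

/-- A vertical period `(0, n)` gives all the periods `(0, b n)`. [folklore] -/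
theorem apply_add_mul_snd_of_shift_eq {z : ℤ × ℤ → A} {n : ℤ} (h : shift ((0 : ℤ), n) z = z)
    (b : ℤ) (p : ℤ × ℤ) : z (p + (0, b * n)) = z p := by
  have step : ∀ q : ℤ × ℤ, z (((0 : ℤ), n) + q) = z q := fun q => by
    have := congrFun h q
    simpa using this
  induction b using Int.induction_on generalizing p with
  | zero =>
    have e : p + ((0 : ℤ), (0 : ℤ) * n) = p := by ext <;> simp
    rw [e]
  | succ b ih =>
    have e : p + ((0 : ℤ), (b + 1) * n) = (0, n) + (p + (0, b * n)) := by
      ext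
      · simp
      · simp only [Prod.snd_add]; ring
    rw [e, step, ih]
  | pred b ih =>
    have e : ((0 : ℤ), n) + (p + (0, (-(b : ℤ) - 1) * n)) = p + (0, -(b : ℤ) * n) := by
      ext
      · simp
      · simp only [Prod.snd_add]; ring
    have := step (p + (0, (-(b : ℤ) - 1) * n))
    rw [e, ih] at this
    exact this.symm

/-- A configuration of `A^{ℤ²}` with finite orbit takes equal values at sites congruent modulo
`m n` (in both coordinates), where `(m, 0)` and `(0, n)` are periods as in
`hasFiniteOrbit_iff_exists_shift_eq`. [folklore] -/
theorem HasFiniteOrbit.exists_apply_eq_of_dvd {z : ℤ × ℤ → A} (hz : HasFiniteOrbit z) :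
    ∃ N : ℕ, 0 < N ∧ ∀ u v : ℤ × ℤ, (N : ℤ) ∣ u.1 - v.1 → (N : ℤ) ∣ u.2 - v.2 → z u = z v := by
  obtain ⟨m, n, hm, hn, hmz, hnz⟩ := (hasFiniteOrbit_iff_exists_shift_eq z).mp hz
  refine ⟨m * n, Nat.mul_pos hm hn, fun u v h1 h2 => ?_⟩
  obtain ⟨a, ha⟩ := h1
  obtain ⟨b, hb⟩ := h2
  have e : u = v + ((a * n) * (m : ℤ), 0) + (0, (b * m) * (n : ℤ)) := by
    ext
    · simp only [Prod.fst_add, add_zero]; push_cast at ha; linarith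
    · simp only [Prod.snd_add]; push_cast at hb; linarith
  rw [e, apply_add_mul_snd_of_shift_eq hnz, apply_add_mul_fst_of_shift_eq hmz]

/-- **Uniform local aperiodicity forbids finite orbits in the closure** (the closure route to
Hochman's Lemma 5.5 + Lemma 5.7): if `z ∈ closure X` had a finite orbit it would be
`Nℤ²`-periodic for some `N ≥ 1`; its central box of radius `R = R(N)` is the central box of some
`x ∈ X`, which contains an `N`-aperiodic pair — two sites where `z` must both differ and agree.
[cite: Hochman2025, Lemma 5.5] -/
theorem IsUniformlyLocallyAperiodic.not_hasFiniteOrbit_of_mem_closure [TopologicalSpace A]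
    [DiscreteTopology A] {X : Set (ℤ × ℤ → A)} (hX : IsUniformlyLocallyAperiodic X)
    {z : ℤ × ℤ → A} (hz : z ∈ closure X) : ¬ HasFiniteOrbit z := by
  classical
  intro hfin
  obtain ⟨N, hN, hper⟩ := hfin.exists_apply_eq_of_dvd
  obtain ⟨R, hR⟩ := hX N hN
  let S : Finset (ℤ × ℤ) := Finset.Icc (-(R : ℤ)) R ×ˢ Finset.Icc (-(R : ℤ)) R
  obtain ⟨x, hxc, hxX⟩ :=
    mem_closure_iff.mp hz (cylinder S z) (isOpen_cylinder S z) (fun _ _ => rfl)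
  obtain ⟨u, v, hu1, hu2, hv1, hv2, hd1, hd2, hne⟩ := hR x hxX 0
  have hmem : ∀ w : ℤ × ℤ, |w.1 - (0 : ℤ × ℤ).1| ≤ R → |w.2 - (0 : ℤ × ℤ).2| ≤ R → w ∈ S := by
    intro w h1 h2
    simp only [Prod.fst_zero, sub_zero, Prod.snd_zero, abs_le] at h1 h2
    simp only [S, Finset.mem_product, Finset.mem_Icc]
    exact ⟨⟨h1.1, h1.2⟩, ⟨h2.1, h2.2⟩⟩
  have hu : x u = z u := hxc u (hmem u hu1 hu2)
  have hv : x v = z v := hxc v (hmem v hv1 hv2)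
  exact hne (by rw [hu, hv, hper u v hd1 hd2])

namespace Hochman2025

/-! ### The core reduction on `ℤ × ℤ` -/

/-- **From a core family to the five properties of Thm. 1.1 on `ℤ × ℤ`.** If `X₀ ⊆ A^{ℤ²}`
(`A` finite, discrete) is non-empty, shift-invariant, strongly irreducible with gap `g` along
finite sets, and uniformly locally aperiodic, then its closure is a non-empty subshift, strongly
irreducible with gap `g` (along all pairs of sets), without finite orbits.
[cite: Hochman2025, Cor 5.9 and §6.1 (closure route)] -/
theorem closure_core [TopologicalSpace A] [DiscreteTopology A] [Finite A] {X₀ : Set (ℤ × ℤ → A)}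
    (hne : X₀.Nonempty) (hinv : IsShiftInvariant X₀) {g : ℝ}
    (hSI : IsFinitelyStronglyIrreducible X₀ g) (hULA : IsUniformlyLocallyAperiodic X₀) :
    (closure X₀).Nonempty ∧ IsSubshift (closure X₀) ∧ IsStronglyIrreducible (closure X₀) g ∧
      ∀ z ∈ closure X₀, ¬ HasFiniteOrbit z :=
  ⟨hne.mono subset_closure, isSubshift_closure hinv,
    hSI.closure.isStronglyIrreducible isClosed_closure,
    fun _ hz => hULA.not_hasFiniteOrbit_of_mem_closure hz⟩

/-! ### Bookkeeping: `ℤ × ℤ` versus `Fin 2 → ℤ` -/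

/-- Read a configuration of `(Fin 2 → ℤ) → A` as a configuration of `ℤ × ℤ → A`. [folklore] -/
def ofFin (x' : (Fin 2 → ℤ) → A) : ℤ × ℤ → A :=
  fun p => x' ![p.1, p.2]

/-- Read a configuration of `ℤ × ℤ → A` as a configuration of `(Fin 2 → ℤ) → A`. [folklore] -/
def toFin (x : ℤ × ℤ → A) : (Fin 2 → ℤ) → A :=
  fun u => x (u 0, u 1)

/-- [folklore] -/
@[simp] theorem ofFin_apply (x' : (Fin 2 → ℤ) → A) (p : ℤ × ℤ) : ofFin x' p = x' ![p.1, p.2] :=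
  rfl

/-- [folklore] -/
@[simp] theorem toFin_apply (x : ℤ × ℤ → A) (u : Fin 2 → ℤ) : toFin x u = x (u 0, u 1) := rfl

/-- [folklore] -/
@[simp] theorem ofFin_toFin (x : ℤ × ℤ → A) : ofFin (toFin x) = x := by
  funext p
  simp

/-- [folklore] -/
@[simp] theorem toFin_ofFin (x' : (Fin 2 → ℤ) → A) : toFin (ofFin x') = x' := by
  funext u
  have hu : ![u 0, u 1] = u := by ext i; fin_cases i <;> rfl
  simp [hu]

/-- [folklore] -/
theorem vec2_add (a b c d : ℤ) : ![a, b] + ![c, d] = ![a + c, b + d] := by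
  ext i
  fin_cases i <;> rfl

/-- Shifts commute with the identification: `ofFin (shift v x') = shift (v 0, v 1) (ofFin x')`.
[folklore] -/
theorem ofFin_shift (v : Fin 2 → ℤ) (x' : (Fin 2 → ℤ) → A) :
    ofFin (shift v x') = shift (v 0, v 1) (ofFin x') := by
  funext p
  simp only [ofFin_apply, shift_apply, Prod.fst_add, Prod.snd_add]
  congr 1
  have hv : ![v 0, v 1] = v := by ext i; fin_cases i <;> rfl
  conv_lhs => rw [← hv]
  rw [vec2_add]

/-- The identification `(a, b) ↦ ![a, b]` is an isometry for the sup-metrics. [folklore] -/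
theorem dist_vec2 (p q : ℤ × ℤ) : dist ![p.1, p.2] ![q.1, q.2] = dist p q := by
  refine le_antisymm ?_ ?_
  · refine (dist_pi_le_iff dist_nonneg).2 fun i => ?_
    fin_cases i <;> simp [Prod.dist_eq]
  · rw [Prod.dist_eq]
    refine max_le ?_ ?_
    · have := dist_le_pi_dist (![p.1, p.2]) (![q.1, q.2]) 0
      simpa using this
    · have := dist_le_pi_dist (![p.1, p.2]) (![q.1, q.2]) 1
      simpa using this

/-- The `(Fin 2 → ℤ)`-version of a family of `ℤ × ℤ`-configurations. [folklore] -/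
def finSet (X : Set (ℤ × ℤ → A)) : Set ((Fin 2 → ℤ) → A) :=
  ofFin ⁻¹' X

/-- [folklore] -/
theorem mem_finSet {X : Set (ℤ × ℤ → A)} {x' : (Fin 2 → ℤ) → A} : x' ∈ finSet X ↔ ofFin x' ∈ X :=
  Iff.rfl

/-- [folklore] -/
theorem finSet_nonempty {X : Set (ℤ × ℤ → A)} (h : X.Nonempty) : (finSet X).Nonempty := by
  obtain ⟨x, hx⟩ := h
  exact ⟨toFin x, by simpa [mem_finSet] using hx⟩

/-- [folklore] -/
theorem isSubshift_finSet [TopologicalSpace A] {X : Set (ℤ × ℤ → A)} (h : IsSubshift X) :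
    IsSubshift (finSet X) := by
  refine ⟨h.1.preimage (continuous_pi fun p => continuous_apply _), fun v x' hx' => ?_⟩
  show ofFin (shift v x') ∈ X
  rw [ofFin_shift]
  exact h.2 _ hx'

/-- Strong irreducibility (same gap) transfers along the isometric identification. [folklore] -/
theorem isStronglyIrreducible_finSet {X : Set (ℤ × ℤ → A)} {g : ℝ}
    (h : IsStronglyIrreducible X g) : IsStronglyIrreducible (finSet X) g := by
  intro E' F' hEF x' hx' y' hy'
  obtain ⟨z, hz, hzx, hzy⟩ := h {p | ![p.1, p.2] ∈ E'} {p | ![p.1, p.2] ∈ F'}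
    (fun p hp q hq => by rw [← dist_vec2]; exact hEF _ hp _ hq) (ofFin x') hx' (ofFin y') hy'
  refine ⟨toFin z, by simpa [mem_finSet] using hz, fun u hu => ?_, fun u hu => ?_⟩
  · have hu' : ![u 0, u 1] = u := by ext i; fin_cases i <;> rfl
    have hmem : ((u 0, u 1) : ℤ × ℤ) ∈ {p : ℤ × ℤ | ![p.1, p.2] ∈ E'} := by
      simpa [hu'] using hu
    simpa [hu'] using hzx hmem
  · have hu' : ![u 0, u 1] = u := by ext i; fin_cases i <;> rfl
    have hmem : ((u 0, u 1) : ℤ × ℤ) ∈ {p : ℤ × ℤ | ![p.1, p.2] ∈ F'} := by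
      simpa [hu'] using hu
    simpa [hu'] using hzy hmem

/-- Finite orbits transfer along the identification. [folklore] -/
theorem hasFiniteOrbit_ofFin {x' : (Fin 2 → ℤ) → A} (h : HasFiniteOrbit x') :
    HasFiniteOrbit (ofFin x') := by
  refine (h.image ofFin).subset ?_
  rintro _ ⟨p, rfl⟩
  refine ⟨shift ![p.1, p.2] x', ⟨![p.1, p.2], rfl⟩, ?_⟩
  show ofFin (shift ![p.1, p.2] x') = shift p (ofFin x')
  rw [ofFin_shift]
  simp

/-- **Thm. 1.1 from a `ℤ × ℤ` example.** [cite: Hochman2025, Thm 1.1] -/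
theorem _root_.Literature.Dynamics.SymbolicDynamics.Hochman2025_existsSIAperiodic.of_int2
    (h : ∃ (k : ℕ) (X : Set (ℤ × ℤ → Fin k)) (g : ℝ),
      0 ≤ g ∧ X.Nonempty ∧ IsSubshift X ∧ IsStronglyIrreducible X g ∧ ∀ x ∈ X, ¬ HasFiniteOrbit x) :
    Hochman2025_existsSIAperiodic := by
  obtain ⟨k, X, g, hg, hne, hsub, hSI, hap⟩ := h
  refine Hochman2025_existsSIAperiodic.of_two ⟨k, finSet X, g, hg, finSet_nonempty hne,
    isSubshift_finSet hsub, isStronglyIrreducible_finSet hSI, fun x' hx' hfin => ?_⟩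
  exact hap (ofFin x') hx' (hasFiniteOrbit_ofFin hfin)

/-- **Hochman 2025, Thm. 1.1, reduced to its combinatorial core**: it suffices to exhibit a
finite alphabet and a family `X₀ ⊆ (Fin k)^{ℤ × ℤ}` which is non-empty, shift-invariant, strongly
irreducible with gap `g` along FINITE sets (Hochman's (B), §6.1), and uniformly locally aperiodic;
the subshift of Thm. 1.1 is then the closure of `X₀` (properties by `closure_core`), read on
`Fin 2 → ℤ` and sliced up to `ℤ^d` (`of_int2`, `of_two`). In the paper `X₀` is the family of
configurations admitting a dense compatible certificate (§5.7), which is finitely strongly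
irreducible with gap `10` by §6 and uniformly locally aperiodic by Lemma 5.5 with the density of
frames. [cite: Hochman2025, Thm 1.1 (§5.7, §6)] -/
theorem _root_.Literature.Dynamics.SymbolicDynamics.Hochman2025_existsSIAperiodic.of_core
    (h : ∃ (k : ℕ) (X₀ : Set (ℤ × ℤ → Fin k)) (g : ℝ), 0 ≤ g ∧ X₀.Nonempty ∧ IsShiftInvariant X₀ ∧
      IsFinitelyStronglyIrreducible X₀ g ∧ IsUniformlyLocallyAperiodic X₀) :
    Hochman2025_existsSIAperiodic := by
  obtain ⟨k, X₀, g, hg, hne, hinv, hSI, hULA⟩ := h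
  obtain ⟨hne', hsub, hSI', hap⟩ := closure_core hne hinv hSI hULA
  exact Hochman2025_existsSIAperiodic.of_int2 ⟨k, closure X₀, g, hg, hne', hsub, hSI', hap⟩

end Hochman2025

end Literature.Dynamics.SymbolicDynamics
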